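import Summits.Ventures.HodgeRepro2.Instance

/-!
# Sextic.lean — the census of rank-four faces for three conjugate pairs (kernel-checked)

Seat p1 (gen 2) of the blind cell pub-hodge-repro2.  TIER3.md §5(g) writes a CM type of a sextic
Galois CM field as `(s₁, s₂, s₃) ∈ {0,1}³` (`s_ν = 1` iff `τ_ν ∈ Φ`, for a fixed CM type
`{τ₁, τ₂, τ₃}`) and asserts that the balanced 4-sets of distinct types (Deligne LNM 900 Ch. I
Prop. 4.4 with `d = 4`) are the two parity tetrahedra and the unions of two conjugate pairs.  This
file proves that census in the kernel and counts: **8 balanced 4-sets = 2 tetrahedra + 6 unions of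
two conjugate pairs** (`card_cubeBalancedSets`, `card_cubeBalancedSets_tetra`,
`card_cubeBalancedSets_conjClosed`; the four conjugate pairs give `C(4,2) = 6` unions).
Part C: the cube model `CubeVertex = Fin 3 → Bool`.  Part D: transport to the embeddings of any CM
field carrying an injective CM type `τ : Fin 3 → (K →+* ℂ)` (`cubeType`); the landed
`parityTetrahedron K τ` is the odd tetrahedron; classification of injective Weil faces
(`isWeilFace_classification`).  Part E: the `ℤ/6` model of `Gal(𝐅/ℚ)` of §5(i) — the inverse
(reflex) relabelling `σ ↦ σ⁻¹` maps each parity tetrahedron onto itself, and each tetrahedron has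
exactly one non-primitive vertex.  All decisions are `decide +kernel` (axioms stay `propext`,
`Classical.choice`, `Quot.sound`).  Nothing here identifies `Gal(𝐅/ℚ)` with `ℤ/6` for a particular
field; part E is the combinatorics of that model.
-/

namespace Summit.Ventures.HodgeRepro2

open NumberField

/-! ## C. The cube model -/

/-- A vertex of the 3-cube: `s ν = true` iff `τ_ν ∈ Φ` — the coordinates `(s₁, s₂, s₃)` of
TIER3 §5(g). -/
abbrev CubeVertex := Fin 3 → Bool

/-- Complex conjugation in the cube model flips every coordinate. -/
def cubeConj (s : CubeVertex) : CubeVertex := fun ν => !s ν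

/-- Balance in the cube model: every coordinate is `true` on exactly two of the four vertices
(Deligne Prop. 4.4, `a_σ = b_σ = 2`). -/
def IsCubeBalanced (T : Fin 4 → CubeVertex) : Prop :=
  ∀ ν : Fin 3, (Finset.univ.filter fun i => T i ν = true).card = 2

/-- The odd parity tetrahedron `111, 100, 010, 001`. -/
def oddTetra : Fin 4 → CubeVertex :=
  ![![true, true, true], ![true, false, false], ![false, true, false], ![false, false, true]]

/-- The even parity tetrahedron `000, 011, 101, 110` (the conjugate of the odd one). -/
def evenTetra : Fin 4 → CubeVertex := fun i => cubeConj (oddTetra i)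

/-- A 4-set closed under conjugation — for four distinct vertices, a union of two conjugate
pairs `{Φ, Φ̄, Φ', Φ̄'}`. -/
def IsCubeConjClosed (T : Fin 4 → CubeVertex) : Prop := ∀ i, ∃ j, T j = cubeConj (T i)

/-- Balance for a set of vertices. -/
def IsCubeBalancedSet (S : Finset CubeVertex) : Prop :=
  S.card = 4 ∧ ∀ ν : Fin 3, (S.filter fun s => s ν = true).card = 2

/-- Balance is decidable. -/
instance : DecidablePred IsCubeBalanced := fun T => by unfold IsCubeBalanced; infer_instance
/-- Conjugation-closure is decidable. -/
instance : DecidablePred IsCubeConjClosed := fun T => by unfold IsCubeConjClosed; infer_instance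
/-- Balance of a set is decidable. -/
instance : DecidablePred IsCubeBalancedSet := fun S => by unfold IsCubeBalancedSet; infer_instance

/-- **Classification** (TIER3 §5(g)): an injective balanced 4-tuple of cube vertices is, as a set,
the odd tetrahedron, the even tetrahedron, or closed under conjugation. -/
theorem cube_classification : ∀ T : Fin 4 → CubeVertex, Function.Injective T → IsCubeBalanced T →
    Finset.univ.image T = Finset.univ.image oddTetra ∨
      Finset.univ.image T = Finset.univ.image evenTetra ∨ IsCubeConjClosed T := by
  decide +kernel

/-- Both tetrahedra are balanced. -/
theorem isCubeBalanced_oddTetra : IsCubeBalanced oddTetra := by decide +kernel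

/-- Both tetrahedra are balanced. -/
theorem isCubeBalanced_evenTetra : IsCubeBalanced evenTetra := by decide +kernel

/-- Neither tetrahedron is closed under conjugation. -/
theorem not_isCubeConjClosed_oddTetra : ¬ IsCubeConjClosed oddTetra := by decide +kernel

/-- Neither tetrahedron is closed under conjugation. -/
theorem not_isCubeConjClosed_evenTetra : ¬ IsCubeConjClosed evenTetra := by decide +kernel

/-- **Count**: there are exactly 8 balanced 4-sets of cube vertices. -/
theorem card_cubeBalancedSets : (Finset.univ.filter IsCubeBalancedSet).card = 8 := by
  decide +kernel

/-- Of these, exactly 2 are not closed under conjugation — the two parity tetrahedra. -/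
theorem card_cubeBalancedSets_tetra :
    (Finset.univ.filter fun S : Finset CubeVertex =>
      IsCubeBalancedSet S ∧ ¬ ∀ s ∈ S, cubeConj s ∈ S).card = 2 := by
  decide +kernel

/-- The two non-conjugation-closed balanced sets are the tetrahedra. -/
theorem cubeBalancedSets_tetra_eq :
    (Finset.univ.filter fun S : Finset CubeVertex =>
      IsCubeBalancedSet S ∧ ¬ ∀ s ∈ S, cubeConj s ∈ S) =
      {Finset.univ.image oddTetra, Finset.univ.image evenTetra} := by
  decide +kernel

/-- And exactly 6 are unions of two conjugate pairs (`C(4,2) = 6`; TIER3 §5(g) prints "three",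
route-2 memo §8.2 prints six — six is the kernel count). -/
theorem card_cubeBalancedSets_conjClosed :
    (Finset.univ.filter fun S : Finset CubeVertex =>
      IsCubeBalancedSet S ∧ ∀ s ∈ S, cubeConj s ∈ S).card = 6 := by
  decide +kernel

/-- Every union of two distinct conjugate pairs is balanced. -/
theorem isCubeBalancedSet_pairUnion (s s' : CubeVertex) (h : s' ≠ s) (h' : s' ≠ cubeConj s) :
    IsCubeBalancedSet {s, cubeConj s, s', cubeConj s'} := by
  revert s s'; decide +kernel

/-- Exactly two vertices of each tetrahedron contain `τ₁` (coordinate `0`): the fact used in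
TIER3 §5(g) ("EXACTLY TWO of its vertices contain τ₁ and two contain τ̄₁"). -/
theorem card_oddTetra_coord_zero :
    (Finset.univ.filter fun i => oddTetra i 0 = true).card = 2 := by decide +kernel

/-! ## D. Transport to the embeddings of a CM field with a chosen CM type of three embeddings -/

section Field

variable {K : Type*} [Field K]

open ComplexEmbedding

/-- The set of embeddings with cube coordinates `s` relative to the base CM type `τ`:
`{τ_ν : s ν = true} ∪ {τ̄_ν : s ν = false}`. -/
def cubeType (τ : Fin 3 → (K →+* ℂ)) (s : CubeVertex) : Set (K →+* ℂ) :=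
  Set.range fun ν => if s ν then τ ν else conjugate (τ ν)

variable {τ : Fin 3 → (K →+* ℂ)} (hinj : Function.Injective τ) (hΦ : IsCMType K (Set.range τ))

include hΦ in
/-- No `τ_ν` is the conjugate of a `τ_μ` (the range of `τ` is a CM type). -/
theorem ne_conjugate_of_isCMType (ν μ : Fin 3) : τ ν ≠ conjugate (τ μ) := by
  intro h
  rcases hΦ (τ μ) with ⟨_, h2⟩ | ⟨_, h2⟩
  · exact h2 ⟨ν, h⟩
  · exact h2 ⟨μ, rfl⟩

include hΦ in
/-- Every embedding is some `τ_ν` or some `τ̄_ν`. -/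
theorem exists_eq_or_eq_conjugate (φ : K →+* ℂ) :
    ∃ ν, φ = τ ν ∨ φ = conjugate (τ ν) := by
  rcases hΦ φ with ⟨⟨ν, hν⟩, _⟩ | ⟨⟨ν, hν⟩, _⟩
  · exact ⟨ν, Or.inl hν.symm⟩
  · refine ⟨ν, Or.inr ?_⟩
    rw [hν]
    exact (star_star φ).symm

include hinj hΦ in
/-- `τ_ν ∈ cubeType τ s ↔ s ν = true`. -/
theorem mem_cubeType_left (s : CubeVertex) (ν : Fin 3) :
    τ ν ∈ cubeType τ s ↔ s ν = true := by
  constructor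
  · rintro ⟨μ, hμ⟩
    dsimp only at hμ
    by_cases hs : s μ = true
    · rw [if_pos hs] at hμ
      rw [← hinj hμ]; exact hs
    · rw [if_neg hs] at hμ
      exact absurd hμ.symm (ne_conjugate_of_isCMType hΦ ν μ)
  · intro hs
    exact ⟨ν, if_pos hs⟩

include hinj hΦ in
/-- `τ̄_ν ∈ cubeType τ s ↔ s ν = false`. -/
theorem mem_cubeType_right (s : CubeVertex) (ν : Fin 3) :
    conjugate (τ ν) ∈ cubeType τ s ↔ s ν = false := by
  constructor
  · rintro ⟨μ, hμ⟩
    dsimp only at hμ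
    by_cases hs : s μ = true
    · rw [if_pos hs] at hμ
      exact absurd hμ (ne_conjugate_of_isCMType hΦ μ ν)
    · rw [if_neg hs] at hμ
      rw [← hinj (star_injective hμ)]
      exact Bool.eq_false_iff.mpr hs
  · intro hs
    exact ⟨ν, if_neg (by simp [hs])⟩

include hinj hΦ in
/-- Every `cubeType τ s` is a CM type. -/
theorem isCMType_cubeType (s : CubeVertex) : IsCMType K (cubeType τ s) := by
  intro φ
  obtain ⟨ν, rfl | rfl⟩ := exists_eq_or_eq_conjugate hΦ φ
  · rw [mem_cubeType_left hinj hΦ, mem_cubeType_right hinj hΦ]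
    cases s ν <;> simp
  · rw [ComplexEmbedding.involutive_conjugate K (τ ν), mem_cubeType_left hinj hΦ,
      mem_cubeType_right hinj hΦ]
    cases s ν <;> simp

include hinj hΦ in
/-- Conjugation of types is `cubeConj` in coordinates. -/
theorem conjCMType_cubeType (s : CubeVertex) :
    conjCMType K (cubeType τ s) = cubeType τ (cubeConj s) := by
  ext φ
  obtain ⟨ν, rfl | rfl⟩ := exists_eq_or_eq_conjugate hΦ φ
  · simp only [conjCMType, Set.mem_setOf_eq]
    rw [mem_cubeType_right hinj hΦ, mem_cubeType_left hinj hΦ]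
    simp only [cubeConj]
    cases s ν <;> simp
  · simp only [conjCMType, Set.mem_setOf_eq]
    rw [ComplexEmbedding.involutive_conjugate K (τ ν), mem_cubeType_left hinj hΦ,
      mem_cubeType_right hinj hΦ]
    simp only [cubeConj]
    cases s ν <;> simp

open Classical in
include hinj hΦ in
/-- Every CM type of `K` is a `cubeType` — with coordinates `ν ↦ [τ_ν ∈ Φ]`. -/
theorem eq_cubeType_of_isCMType {Φ : Set (K →+* ℂ)} (h : IsCMType K Φ) :
    Φ = cubeType τ (fun ν => decide (τ ν ∈ Φ)) := by
  ext φ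
  obtain ⟨ν, rfl | rfl⟩ := exists_eq_or_eq_conjugate hΦ φ
  · rw [mem_cubeType_left hinj hΦ]
    simp
  · rw [mem_cubeType_right hinj hΦ]
    have hx := h (τ ν)
    simp only [decide_eq_false_iff_not]
    rcases hx with ⟨h1, h2⟩ | ⟨h1, h2⟩
    · exact ⟨fun h' => absurd h' h2, fun h' => absurd h1 h'⟩
    · exact ⟨fun _ => h2, fun _ => h1⟩

include hinj hΦ in
/-- `cubeType τ` is injective in the coordinates. -/
theorem cubeType_injective : Function.Injective (cubeType τ) := by
  intro s s' h
  funext ν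
  have := mem_cubeType_left hinj hΦ s ν
  rw [h, mem_cubeType_left hinj hΦ] at this
  cases hs : s ν <;> cases hs' : s' ν <;> simp_all

/-- The landed `parityTetrahedron K τ` is the odd tetrahedron in coordinates. -/
theorem parityTetrahedron_eq_cubeType (τ : Fin 3 → (K →+* ℂ)) :
    parityTetrahedron K τ = fun i => cubeType τ (oddTetra i) := by
  funext i
  unfold parityTetrahedron cubeType
  congr 1
  funext ν
  have key : (i = 0 ∨ (i : ℕ) = (ν : ℕ) + 1) ↔ oddTetra i ν = true := by
    revert i ν; decide
  by_cases h : oddTetra i ν = true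
  · rw [if_pos (key.mpr h), if_pos h]
  · rw [if_neg (fun h' => h (key.mp h')), if_neg h]

include hinj hΦ in
/-- A 4-tuple of cube types is a Weil face iff its coordinates are balanced. -/
theorem isWeilFace_cubeType_iff (T : Fin 4 → CubeVertex) :
    IsWeilFace K (fun i => cubeType τ (T i)) ↔ IsCubeBalanced T := by
  classical
  have hcardL : ∀ ν, Nat.card {i // τ ν ∈ cubeType τ (T i)} =
      (Finset.univ.filter fun i => T i ν = true).card := fun ν => by
    rw [Nat.card_eq_fintype_card, Fintype.card_subtype]
    congr 1
    ext i
    simp only [Finset.mem_filter, Finset.mem_univ, true_and, mem_cubeType_left hinj hΦ]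
  constructor
  · rintro ⟨_, h2⟩ ν
    rw [← hcardL]
    exact h2 (τ ν)
  · intro hbal
    refine ⟨fun i => isCMType_cubeType hinj hΦ (T i), fun φ => ?_⟩
    obtain ⟨ν, rfl | rfl⟩ := exists_eq_or_eq_conjugate hΦ φ
    · rw [hcardL]; exact hbal ν
    · rw [Nat.card_eq_fintype_card, Fintype.card_subtype]
      have h4 : (Finset.univ.filter fun i => T i ν = true).card +
          (Finset.univ.filter fun i => ¬ T i ν = true).card = 4 :=
        Finset.card_filter_add_card_filter_not _
      have hne : (Finset.univ.filter fun i => conjugate (τ ν) ∈ cubeType τ (T i)) =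
          Finset.univ.filter fun i => ¬ T i ν = true := by
        ext i
        simp only [Finset.mem_filter, Finset.mem_univ, true_and, mem_cubeType_right hinj hΦ,
          Bool.not_eq_true]
      rw [hne]
      have := hbal ν
      omega

include hinj hΦ in
/-- **Classification of injective Weil faces** for a CM field carrying a CM type of three
embeddings (in particular every sextic CM field): up to the order of the vertices, the face is
the parity tetrahedron of `τ`, its conjugate (the even tetrahedron), or closed under
conjugation (a union of two conjugate pairs). -/
theorem isWeilFace_classification (T : Fin 4 → Set (K →+* ℂ)) (hT : IsWeilFace K T)
    (hinjT : Function.Injective T) :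
    Set.range T = Set.range (parityTetrahedron K τ) ∨
      Set.range T = Set.range (fun i => conjCMType K (parityTetrahedron K τ i)) ∨
      ∀ i, ∃ j, T j = conjCMType K (T i) := by
  classical
  set c : Fin 4 → CubeVertex := fun i ν => decide (τ ν ∈ T i) with hc
  have hTc : T = fun i => cubeType τ (c i) := by
    funext i
    exact eq_cubeType_of_isCMType hinj hΦ (hT.1 i)
  have hcinj : Function.Injective c := by
    intro i j hij
    apply hinjT
    rw [hTc]
    simp only [hij]
  have hcbal : IsCubeBalanced c := by
    rw [hTc] at hT
    exact (isWeilFace_cubeType_iff hinj hΦ c).mp hT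
  have hrange : ∀ (f : Fin 4 → CubeVertex), Set.range (fun i => cubeType τ (f i)) =
      cubeType τ '' (↑(Finset.univ.image f) : Set CubeVertex) := fun f => by
    rw [Finset.coe_image, Finset.coe_univ, Set.image_univ, ← Set.range_comp]
    rfl
  rcases cube_classification c hcinj hcbal with h | h | h
  · left
    rw [hTc, parityTetrahedron_eq_cubeType, hrange, hrange, h]
  · right; left
    have : (fun i => conjCMType K (parityTetrahedron K τ i)) =
        fun i => cubeType τ (evenTetra i) := by
      funext i
      rw [parityTetrahedron_eq_cubeType, conjCMType_cubeType hinj hΦ]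
      rfl
    rw [hTc, this, hrange, hrange, h]
  · right; right
    intro i
    obtain ⟨j, hj⟩ := h i
    refine ⟨j, ?_⟩
    have h1 : T j = cubeType τ (c j) := by rw [hTc]
    have h2 : T i = cubeType τ (c i) := by rw [hTc]
    rw [h1, h2, conjCMType_cubeType hinj hΦ, hj]

end Field

/-! ## E. The `ℤ/6` model of `Gal(𝐅/ℚ)` (TIER3 §5(i)): inversion and primitivity -/

/-- The `ℤ/6` model: the embedding `σ_k`, `k ∈ ℤ/6`, complex conjugation `k ↦ k + 3`, base CM
type `{0, 1, 2}`; the CM type with coordinates `s` is `{k_ν}` with `k_ν = ν` if `s ν` and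
`k_ν = ν + 3` otherwise. -/
def zType (s : CubeVertex) : Finset (ZMod 6) :=
  Finset.univ.image fun ν : Fin 3 => if s ν then ((ν : ℕ) : ZMod 6) else ((ν : ℕ) : ZMod 6) + 3

/-- The inverse (reflex) relabelling `σ ↦ σ⁻¹` in the `ℤ/6` model: negation. -/
def zInv (Φ : Finset (ZMod 6)) : Finset (ZMod 6) := Φ.image Neg.neg

/-- A CM type in the `ℤ/6` model is primitive if no non-zero translation preserves it
(Shimura 1998 §8.4: then the reflex field is the whole field). -/
def IsZPrimitive (Φ : Finset (ZMod 6)) : Prop :=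
  ∀ g : ZMod 6, Φ.image (fun k => g + k) = Φ → g = 0

/-- Primitivity in the model is decidable. -/
instance : DecidablePred IsZPrimitive := fun Φ => by unfold IsZPrimitive; infer_instance

/-- `zType` is a CM type: of each pair `{k, k + 3}` exactly one member. -/
theorem zType_xor (s : CubeVertex) (k : ZMod 6) : Xor (k ∈ zType s) (k + 3 ∈ zType s) := by
  revert s k; decide +kernel

/-- The inverse of a cube type is a cube type (the model's form of `isCMType_inverseType`). -/
theorem exists_zInv_zType_eq (s : CubeVertex) : ∃ s', zInv (zType s) = zType s' := by
  revert s; decide +kernel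

/-- **Inversion maps the odd tetrahedron onto itself** (as a set of four types). -/
theorem zInv_oddTetra :
    Finset.univ.image (fun i => zInv (zType (oddTetra i))) =
      Finset.univ.image (fun i => zType (oddTetra i)) := by
  decide +kernel

/-- **Inversion maps the even tetrahedron onto itself.** -/
theorem zInv_evenTetra :
    Finset.univ.image (fun i => zInv (zType (evenTetra i))) =
      Finset.univ.image (fun i => zType (evenTetra i)) := by
  decide +kernel

/-- Inversion fixes the base point `0 = τ₁`: a type contains `τ₁` iff its inverse does
("inversion preserves … the parity of the number of vertices containing τ₁", §5(i)). -/
theorem zero_mem_zInv_iff (Φ : Finset (ZMod 6)) : 0 ∈ zInv Φ ↔ 0 ∈ Φ := by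
  simp [zInv]

/-- Exactly 2 of the 8 cube types are non-primitive: `010 = {1, 3, 5}` and `101 = {0, 2, 4}`,
the two types induced from the imaginary quadratic subfield (cosets of `{0, 2, 4}`). -/
theorem card_nonPrimitive :
    (Finset.univ.filter fun s : CubeVertex => ¬ IsZPrimitive (zType s)).card = 2 := by
  decide +kernel

/-- The non-primitive types are exactly `010` and `101`. -/
theorem nonPrimitive_eq :
    (Finset.univ.filter fun s : CubeVertex => ¬ IsZPrimitive (zType s)) =
      {![false, true, false], ![true, false, true]} := by
  decide +kernel

/-- **Each tetrahedron contains exactly one non-primitive vertex** (TIER3 §5(i)). -/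
theorem card_nonPrimitive_oddTetra :
    (Finset.univ.filter fun i => ¬ IsZPrimitive (zType (oddTetra i))).card = 1 := by
  decide +kernel

/-- **Each tetrahedron contains exactly one non-primitive vertex** (TIER3 §5(i)). -/
theorem card_nonPrimitive_evenTetra :
    (Finset.univ.filter fun i => ¬ IsZPrimitive (zType (evenTetra i))).card = 1 := by
  decide +kernel

/-- The inverse of a primitive type is primitive (in the model; `isPrimitiveOn_inv_of_comm` in
general). -/
theorem isZPrimitive_zInv (s : CubeVertex) (h : IsZPrimitive (zType s)) :
    IsZPrimitive (zInv (zType s)) := by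
  revert s; decide +kernel

end Summit.Ventures.HodgeRepro2
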